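import Mathlib
import Literature.Analysis.FluidPDE.Tao2016AveragedNS.ShiftSetCascadeFlows
import Summits.NavierStokesRegularity.NavierStokesRegularity.Theorems.TaoLadderRungTwoFlatCertificateGlueCheckerStepJ2On
import Summits.NavierStokesRegularity.NavierStokesRegularity.Theorems.TaoLadderRungTwoFlatCertificateGlueVarTailOn
import HarnessLib

/-!
# Certificate glue on a shift set `𝕊`, XXXVIII-l: THE FRAME ENCLOSURE AND THE REMAINDER-DIRECTION BOUND AT A LOWER VARIATIONAL ORDER `pᵥ` PLUS THE
  MAJORANT TAIL — `kappa_of_kappaArrJ_tail`, `nve_of_nveArrJ_tail` (glue XXXVIII-d / XXXVIII-i at order `pᵥ`, lifted to order `p` by glue XXXVIII-k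
  `abs_VPoly_sub_VPoly_le`), and the C8 test `checkERecV3` carrying the tail term `2·ρ_s·tailVQ pᵥ p b m′ h` on the row factor, with `eRecV3_of_check`
  (helper for items stmt-NavierStokesRegularity-22987 `FlatGapCertificatesV2` (crux K_A♭ of route TaoLadderRungTwoFlat) and stmt-24295 K_A₂(64); cell
  harvest/h2-tao-ladder, p1 g18; PERFORMANCE: the two variational passes cost `O(pᵥ²)` instead of `O(p²)` — at `pᵥ = 4`, `p = 16`: `10` sparse products
  instead of `136`)

HONEST FRAMING: Tao-type MODEL lattices (Tao 2016 §4/§6 vocabulary, shift-set parametrised); checker soundness — no certificate data, nothing certified, no stub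
closed, nothing here is a statement about the Navier–Stokes equations.
-/

noncomputable section

-- the sub-problem namespace repeats the summit name by design (D-0017)
set_option linter.dupNamespace false

namespace Summit.NavierStokesRegularity.NavierStokesRegularity.Theorems

open Set Finset Literature.Analysis.FluidPDE Literature.Analysis.FluidPDE.TaoCascade
open Summit.NavierStokesRegularity.NavierStokesRegularity.Theorems.TaylorModelCert
open Summit.NavierStokesRegularity.NavierStokesRegularity.Theorems.TaylorModelReadout
open Summit.NavierStokesRegularity.NavierStokesRegularity.Theorems.TaylorModelMajorant

namespace CertificateGlueOn

variable {m : ℕ} {Kb Ka : ℤ}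

/-! ### The C8 test with the variational tail -/

/-- **The C8v3 test**: `dP_c + κ_c + NVE_c + bRowSum_c · (remRowQ p b m′ h + 2·ρ_s·tailVQ pᵥ p b m′ h) ≤ E'_c` (`m′ = mC + ρs`) at every window coordinate,
exactly. [folklore] -/
def checkERecV3 (m : ℕ) (Kb Ka : ℤ) (shifts : List (ℤ × ℤ × ℤ)) (coefB : Fin m → ℤ → Fin m → Fin m → ℤ × ℤ × ℤ → IntervalD) (p pv : ℕ)
    (b mC ρs h : ℚ) (dPA κA nveA E1D : Array Dyad) : Bool :=
  let tl := remRowQ p b (mC + ρs) h + 2 * ρs * tailVQ pv p b (mC + ρs) h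
  (List.finRange m).all fun i => (List.range (winLen Kb Ka)).all fun cc =>
    let c := cc + winLen Kb Ka * i.val
    decide (dyadToRat (dgetD dPA c) + dyadToRat (dgetD κA c) + dyadToRat (dgetD nveA c) +
      dyadToRat (bRowSum Kb Ka shifts coefB i ((cc : ℤ) - Kb)) * tl ≤ dyadToRat (dgetD E1D c))

/-- **C8v3 FROM THE TEST**, cast to `ℝ`. [folklore] -/
theorem eRecV3_of_check {shifts : List (ℤ × ℤ × ℤ)} {coefB : Fin m → ℤ → Fin m → Fin m → ℤ × ℤ × ℤ → IntervalD} {p pv : ℕ} {b mC ρs h : ℚ}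
    {dPA κA nveA E1D : Array Dyad} (hc : checkERecV3 m Kb Ka shifts coefB p pv b mC ρs h dPA κA nveA E1D = true) (hKK : 0 ≤ Ka + Kb + 1) :
    ∀ c : Fin (m * winLen Kb Ka), (dgetD dPA c).toReal + (dgetD κA c).toReal + (dgetD nveA c).toReal +
      (bRowSum Kb Ka shifts coefB (finProdFinEquiv.symm c).1 (shellAt Kb (finProdFinEquiv.symm c).2)).toReal *
        (((mC : ℝ) + (ρs : ℝ)) ^ 2 * (h : ℝ) * ((b : ℝ) * ((mC : ℝ) + (ρs : ℝ)) * (h : ℝ)) ^ p /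
          (1 - (b : ℝ) * ((mC : ℝ) + (ρs : ℝ)) * (h : ℝ)) +
          2 * (ρs : ℝ) * tailVR pv p (b : ℝ) ((mC : ℝ) + (ρs : ℝ)) (h : ℝ)) ≤
      dvec (n := m * winLen Kb Ka) E1D c := by
  intro c
  simp only [checkERecV3, List.all_eq_true, List.mem_finRange, List.mem_range, decide_eq_true_eq, true_implies] at hc
  have hval := val_eq_of_symm c
  have hkm := shellAt_mem hKK (finProdFinEquiv.symm c).2
  set k := shellAt Kb (finProdFinEquiv.symm c).2 with hk
  obtain ⟨hk1, hk2⟩ := hkm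
  have hcc : (k + Kb).toNat < winLen Kb Ka := by
    unfold winLen; rw [Int.toNat_lt_toNat (by omega)]; omega
  have h1 := hc (finProdFinEquiv.symm c).1 (k + Kb).toNat hcc
  rw [Int.toNat_of_nonneg (by omega), show k + Kb - Kb = k by ring, hval] at h1
  have h2 := (Rat.cast_le (K := ℝ)).mpr h1
  simp only [Rat.cast_add, Rat.cast_mul, cast_dyadToRat, remRowQ, Rat.cast_div, Rat.cast_pow, Rat.cast_sub, Rat.cast_one, cast_tailVQ,
    Rat.cast_ofNat] at h2
  simpa [dvec] using h2

/-! ### The node box in unit weights -/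

/-- A state of the hull box has sup norm `≤ mC + ρs`. [folklore] -/
theorem abs_le_of_hullBox {n : ℕ} {xD ρD ED : Array Dyad} {mC ρs : ℝ} (hx : ∀ c : Fin n, |dvec (n := n) xD c| ≤ mC)
    (hρE : ∀ c : Fin n, dvec (n := n) ρD c + dvec (n := n) ED c ≤ ρs) {z : Fin n → ℝ}
    (hz : ∀ d, |z d - dvec (n := n) xD d| ≤ dvec (n := n) ρD d + dvec (n := n) ED d) :
    ∀ c, |z c| ≤ (mC + ρs) * (fun _ : Fin n => (1 : ℝ)) c := by
  intro c
  have h1 : |z c| ≤ |z c - dvec (n := n) xD c| + |dvec (n := n) xD c| := by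
    have := abs_add_le (z c - dvec (n := n) xD c) (dvec (n := n) xD c); simpa using this
  simp only [mul_one]
  linarith [hz c, hx c, hρE c]

/-! ### κ and NVE at order `pᵥ`, lifted to order `p` -/

variable {ω : Fin m → ℤ → ℝ} {ε₀ : ℝ} {α : Fin m → Fin m → Fin m → ℤ × ℤ × ℤ → ℝ}
  {shifts : List (ℤ × ℤ × ℤ)} {prec : ℕ} {coefB : Fin m → ℤ → Fin m → Fin m → ℤ × ℤ × ℤ → IntervalD}

/-- **THE FRAME ENCLOSURE OF ORDER `p` FROM THE ORDER-`pᵥ` COMPUTATION AND THE TAIL**: for `z` in the hull box and `ξ` in the `r`-box,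
`|VPoly_p(z)(Cξ)_c − (Cn T ξ)_c| ≤ κ^{(pᵥ)}_c + b_c·ρ_s·tailVR pᵥ p b (mC+ρs) u`, where `κ^{(pᵥ)} = kappaArr` against `vcolsJ` at order `pᵥ`.
[cite: Zgliczynski2002C1Lohner, §3–4 (Lohner-type parallelepiped frames: mean-value form); cell certificate format, checker clauses] -/
theorem kappa_of_kappaArrJ_tail (hKb : 0 ≤ Kb) (hKa : 1 ≤ Ka) (hnd : shifts.Nodup) (hcoef : CoefBoxOK shifts ε₀ α Kb Ka ω coefB)
    {b : ℝ} (hMS : IsMajorantSystem (m * winLen Kb Ka) (PQcN shifts.toFinset ε₀ α Kb Ka ω) (fun _ => (1 : ℝ)) b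
      (taylorJet (PQcN shifts.toFinset ε₀ α Kb Ka ω)) (varJet (PQcN shifts.toFinset ε₀ α Kb Ka ω)))
    (hBrow : ∀ (y z : Fin (m * winLen Kb Ka) → ℝ) (Ny Nz : ℝ), 0 ≤ Ny → 0 ≤ Nz → (∀ d, |y d| ≤ Ny * (fun _ : Fin (m * winLen Kb Ka) => (1 : ℝ)) d) →
      (∀ d, |z d| ≤ Nz * (fun _ : Fin (m * winLen Kb Ka) => (1 : ℝ)) d) → ∀ d, |PQcN shifts.toFinset ε₀ α Kb Ka ω y z d| ≤
        (bRowSum Kb Ka shifts coefB (finProdFinEquiv.symm d).1 (shellAt Kb (finProdFinEquiv.symm d).2)).toReal * Ny * Nz *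
          (fun _ : Fin (m * winLen Kb Ka) => (1 : ℝ)) d)
    {p pv : ℕ} (hpv : pv ≤ p) (xD ρD ED : Array Dyad) {H : IntervalD} {u : ℝ} (hu : IntervalD.mem u H) (hu0 : 0 ≤ u)
    (C Cn T : Array (Array Dyad)) (rD : Array Dyad) {mC ρs : ℝ} (hx : ∀ c, |dvec (n := m * winLen Kb Ka) xD c| ≤ mC)
    (hρE : ∀ c, dvec (n := m * winLen Kb Ka) ρD c + dvec (n := m * winLen Kb Ka) ED c ≤ ρs)
    (hE0 : ∀ c, 0 ≤ dvec (n := m * winLen Kb Ka) ED c)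
    (hCρ : ∀ ξ : Fin (m * winLen Kb Ka) → ℝ, (∀ c, |ξ c| ≤ dvec (n := m * winLen Kb Ka) rD c) →
      ∀ c, |(dmat (n := m * winLen Kb Ka) C).mulVec ξ c| ≤ dvec (n := m * winLen Kb Ka) ρD c) :
    ∀ z : Fin (m * winLen Kb Ka) → ℝ,
      (∀ d, |z d - dvec (n := m * winLen Kb Ka) xD d| ≤ dvec (n := m * winLen Kb Ka) ρD d + dvec (n := m * winLen Kb Ka) ED d) →
      ∀ ξ : Fin (m * winLen Kb Ka) → ℝ, (∀ c, |ξ c| ≤ dvec (n := m * winLen Kb Ka) rD c) →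
      ∀ c, |(VPoly (PQcN shifts.toFinset ε₀ α Kb Ka ω) p z ((dmat (n := m * winLen Kb Ka) C).mulVec ξ) u -
          (dmat (n := m * winLen Kb Ka) Cn).mulVec ((dmat (n := m * winLen Kb Ka) T).mulVec ξ)) c| ≤
        (dgetD (kappaArr prec (m * winLen Kb Ka) Cn T
          (vcolsJ Kb Ka prec shifts coefB pv (IntervalD.jetLevelsA (m * winLen Kb Ka) (pqBoxA Kb Ka prec shifts coefB) prec
            (hullBoxA (m * winLen Kb Ka) xD ρD ED) pv) H C) rD) c).toReal +
        (bRowSum Kb Ka shifts coefB (finProdFinEquiv.symm c).1 (shellAt Kb (finProdFinEquiv.symm c).2)).toReal * ρs *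
          tailVR pv p b (mC + ρs) u := by
  intro z hz ξ hξ c
  have hpv' := kappa_of_kappaArrJ (prec := prec) hKb hKa hnd hcoef pv xD ρD ED hu C Cn T rD z hz ξ hξ c
  have hzb := abs_le_of_hullBox hx hρE hz
  have hvb : ∀ d, |(dmat (n := m * winLen Kb Ka) C).mulVec ξ d| ≤ ρs * (fun _ : Fin (m * winLen Kb Ka) => (1 : ℝ)) d := fun d => by
    simp only [mul_one]; linarith [hCρ ξ hξ d, hρE d, hE0 d]
  have htail := abs_VPoly_sub_VPoly_le hMS hBrow hzb hvb hpv hu0 c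
  simp only [mul_one] at htail
  have key : |(VPoly (PQcN shifts.toFinset ε₀ α Kb Ka ω) p z ((dmat (n := m * winLen Kb Ka) C).mulVec ξ) u -
      (dmat (n := m * winLen Kb Ka) Cn).mulVec ((dmat (n := m * winLen Kb Ka) T).mulVec ξ)) c| ≤
      |(VPoly (PQcN shifts.toFinset ε₀ α Kb Ka ω) pv z ((dmat (n := m * winLen Kb Ka) C).mulVec ξ) u -
        (dmat (n := m * winLen Kb Ka) Cn).mulVec ((dmat (n := m * winLen Kb Ka) T).mulVec ξ)) c| +
      |VPoly (PQcN shifts.toFinset ε₀ α Kb Ka ω) p z ((dmat (n := m * winLen Kb Ka) C).mulVec ξ) u c -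
        VPoly (PQcN shifts.toFinset ε₀ α Kb Ka ω) pv z ((dmat (n := m * winLen Kb Ka) C).mulVec ξ) u c| := by
    have e : (VPoly (PQcN shifts.toFinset ε₀ α Kb Ka ω) p z ((dmat (n := m * winLen Kb Ka) C).mulVec ξ) u -
        (dmat (n := m * winLen Kb Ka) Cn).mulVec ((dmat (n := m * winLen Kb Ka) T).mulVec ξ)) c =
        (VPoly (PQcN shifts.toFinset ε₀ α Kb Ka ω) pv z ((dmat (n := m * winLen Kb Ka) C).mulVec ξ) u -
          (dmat (n := m * winLen Kb Ka) Cn).mulVec ((dmat (n := m * winLen Kb Ka) T).mulVec ξ)) c +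
        (VPoly (PQcN shifts.toFinset ε₀ α Kb Ka ω) p z ((dmat (n := m * winLen Kb Ka) C).mulVec ξ) u c -
          VPoly (PQcN shifts.toFinset ε₀ α Kb Ka ω) pv z ((dmat (n := m * winLen Kb Ka) C).mulVec ξ) u c) := by
      simp only [Pi.sub_apply]; ring
    rw [e]; exact abs_add_le _ _
  linarith

/-- **THE REMAINDER-DIRECTION BOUND OF ORDER `p` FROM THE ORDER-`pᵥ` COMPUTATION AND THE TAIL**: for `z` in the hull box and `e` in `[−E, E]`,
`|VPoly_p(z)(e)_c| ≤ NVE^{(pᵥ)}_c + b_c·ρ_s·tailVR pᵥ p b (mC+ρs) u` with `NVE^{(pᵥ)} = nveArr` of the one-direction table at order `pᵥ`.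
[cite: Zgliczynski2002C1Lohner, §3–4 (the variational part); cell certificate format, checker clauses] -/
theorem nve_of_nveArrJ_tail (hKb : 0 ≤ Kb) (hKa : 1 ≤ Ka) (hnd : shifts.Nodup) (hcoef : CoefBoxOK shifts ε₀ α Kb Ka ω coefB)
    {b : ℝ} (hMS : IsMajorantSystem (m * winLen Kb Ka) (PQcN shifts.toFinset ε₀ α Kb Ka ω) (fun _ => (1 : ℝ)) b
      (taylorJet (PQcN shifts.toFinset ε₀ α Kb Ka ω)) (varJet (PQcN shifts.toFinset ε₀ α Kb Ka ω)))
    (hBrow : ∀ (y z : Fin (m * winLen Kb Ka) → ℝ) (Ny Nz : ℝ), 0 ≤ Ny → 0 ≤ Nz → (∀ d, |y d| ≤ Ny * (fun _ : Fin (m * winLen Kb Ka) => (1 : ℝ)) d) →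
      (∀ d, |z d| ≤ Nz * (fun _ : Fin (m * winLen Kb Ka) => (1 : ℝ)) d) → ∀ d, |PQcN shifts.toFinset ε₀ α Kb Ka ω y z d| ≤
        (bRowSum Kb Ka shifts coefB (finProdFinEquiv.symm d).1 (shellAt Kb (finProdFinEquiv.symm d).2)).toReal * Ny * Nz *
          (fun _ : Fin (m * winLen Kb Ka) => (1 : ℝ)) d)
    {p pv : ℕ} (hpv : pv ≤ p) (xD ρD ED : Array Dyad) {H : IntervalD} {u : ℝ} (hu : IntervalD.mem u H) (hu0 : 0 ≤ u)
    {mC ρs : ℝ} (hx : ∀ c, |dvec (n := m * winLen Kb Ka) xD c| ≤ mC)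
    (hρE : ∀ c, dvec (n := m * winLen Kb Ka) ρD c + dvec (n := m * winLen Kb Ka) ED c ≤ ρs)
    (hρ0 : ∀ c, 0 ≤ dvec (n := m * winLen Kb Ka) ρD c) :
    ∀ z : Fin (m * winLen Kb Ka) → ℝ,
      (∀ d, |z d - dvec (n := m * winLen Kb Ka) xD d| ≤ dvec (n := m * winLen Kb Ka) ρD d + dvec (n := m * winLen Kb Ka) ED d) →
      ∀ e : Fin (m * winLen Kb Ka) → ℝ, (∀ c, |e c| ≤ dvec (n := m * winLen Kb Ka) ED c) →
      ∀ c, |VPoly (PQcN shifts.toFinset ε₀ α Kb Ka ω) p z e u c| ≤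
        (dgetD (nveArr (m * winLen Kb Ka) (IntervalD.polyLevelsA (m * winLen Kb Ka) prec
          (varVecLevelsA (m * winLen Kb Ka) prec (jacLevelsA (pqJacA Kb Ka prec shifts coefB)
            (IntervalD.jetLevelsA (m * winLen Kb Ka) (pqBoxA Kb Ka prec shifts coefB) prec (hullBoxA (m * winLen Kb Ka) xD ρD ED) pv) pv)
            (symBoxA (m * winLen Kb Ka) ED) pv) pv H)) c).toReal +
        (bRowSum Kb Ka shifts coefB (finProdFinEquiv.symm c).1 (shellAt Kb (finProdFinEquiv.symm c).2)).toReal * ρs *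
          tailVR pv p b (mC + ρs) u := by
  intro z hz e he c
  have hpv' := abs_VPoly_le_nveArrJ (prec := prec) hKb hKa hnd hcoef pv xD ρD ED hu z hz e he c
  have hzb := abs_le_of_hullBox hx hρE hz
  have heb : ∀ d, |e d| ≤ ρs * (fun _ : Fin (m * winLen Kb Ka) => (1 : ℝ)) d := fun d => by
    simp only [mul_one]; linarith [he d, hρE d, hρ0 d]
  have htail := abs_VPoly_sub_VPoly_le hMS hBrow hzb heb hpv hu0 c
  simp only [mul_one] at htail
  have key : |VPoly (PQcN shifts.toFinset ε₀ α Kb Ka ω) p z e u c| ≤ |VPoly (PQcN shifts.toFinset ε₀ α Kb Ka ω) pv z e u c| +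
      |VPoly (PQcN shifts.toFinset ε₀ α Kb Ka ω) p z e u c - VPoly (PQcN shifts.toFinset ε₀ α Kb Ka ω) pv z e u c| := by
    have := abs_add_le (VPoly (PQcN shifts.toFinset ε₀ α Kb Ka ω) pv z e u c)
      (VPoly (PQcN shifts.toFinset ε₀ α Kb Ka ω) p z e u c - VPoly (PQcN shifts.toFinset ε₀ α Kb Ka ω) pv z e u c)
    simpa using this
  linarith

end CertificateGlueOn

end Summit.NavierStokesRegularity.NavierStokesRegularity.Theorems

end
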